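import Mathlib
import Summits.Ventures.PercRepro2.Star3Masses
import Summits.Ventures.PercRepro2.Star3Key
import Summits.Ventures.PercRepro2.MixChordOStarMain

/-!
# THE THREE-PIN STAR: the `o`-class `D·Z`-chord along `{o, a₁}` (blind cell PercRepro2, night-1 g27;
proofs/NIGHT1-G26.md §6–§7)

`a₃` has exactly the three edges `g = {a₃, o}`, `e = {a₃, a₁}`, `d = {a₃, a₂}` (weights `r`, `t1`, `t2`) — the
class where the `o`-class `D`-chord is FALSE (NEG-206, g26 §3) and the `D·Z` normaliser is exactly what is needed.
**`dzChord_o_edge_of_three_pin_star`**: `NMixChord (normDZ ends a₁ a₂ a₃) p ends o a₁ a₂ a₃ b f` along the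
`o`-edge `f = {o, a₁}`.  Proof: the dictionary `Gc_star3` / `N_star3` (Star3Masses.lean) writes `Gc` and `D·Z`
of `p` and of `p[f ↦ 0]` as the mixture polynomials `Gc3_mix` / `N3_mix` in the masses of the base instance
`p₀₀₀ = p[g ↦ 0][e ↦ 0][d ↦ 0]`; the `o`-edge pins write the masses of `p₀₀₀` as mixtures of those at
`p₀₀₀[f ↦ 0]` and `p₀₀₀[f ↦ 1]`; at `p₀₀₀[f ↦ 1]` `o ∈ C₁` surely (g19's identifications) and g18's couplings give
`Z¹ = Z⁰ − Ho⁰`, `B¹ = Hb⁰ − HH⁰` and — the EXACT coupling proved here (`prob_Q_conn1_update_one_eq`) —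
`L¹ = Lb⁰ − HL⁰ + W` with the coupling mass `W = P⁰(PD_o ∩ {o ↔ b})`; the four covariance signs at
`p₀₀₀[f ↦ 0]` (`covC_same_nonneg` at both roots, `covC_cross_nonpos`) and the box are the hypotheses of the
algebraic key `star3_key_dz` (Star3Key.lean); the degenerate case `Z⁰ = 0` forces `Z(p[f ↦ 0]) = 0` and both
sides vanish.  Own code; standard axioms.
-/

namespace Summit.Ventures.PercRepro2

open UnionCluster CovForm

namespace Mix

open OStar

namespace OStar3

section Coupling

variable {V : Type*} {E : Type*} [Fintype E] [DecidableEq E] {R : Type*} [Field R]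
  [LinearOrder R] [IsStrictOrderedRing R]

variable (p : E → R) (ends : E → Sym2 V) {o a₁ : V} (a₂ b : V) {f : E} (hf : ends f = s(o, a₁))

omit [Fintype E] [LinearOrder R] [IsStrictOrderedRing R] in
include hf in
/-- Opening `f = {o, a₁}`: `{a₂ ↮ a₁, a₁ ↔ b}` afterwards iff `{a₂ ↮ a₁, a₂ ↮ o}` and (`a₁ ↔ b` or `o ↔ b`) before. -/
lemma Q_conn1_update_true_iff (ω : Config E) :
    Function.update ω f true ∈ avoidAll ends a₂ {a₁} ∩ connEvent ends a₁ b ↔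
      Function.update ω f false ∈
        avoidAll ends a₂ {a₁} ∩ (connEvent ends a₂ o)ᶜ ∩ (connEvent ends a₁ b ∪ connEvent ends o b) := by
  rw [Set.mem_inter_iff, RootEdge.Q_update_true_iff ends hf ω]
  have hup : Function.update ω f true = Function.update (Function.update ω f false) f true := by
    rw [Function.update_idem]
  rw [hup]
  simp only [Set.mem_inter_iff, Set.mem_union, mem_connEvent, OneEdge.conn_update_true_iff hf]
  constructor
  · rintro ⟨hQ, h | ⟨-, h⟩ | ⟨-, h⟩⟩
    · exact ⟨hQ, Or.inl h⟩
    · exact ⟨hQ, Or.inl h⟩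
    · exact ⟨hQ, Or.inr h⟩
  · rintro ⟨hQ, h | h⟩
    · exact ⟨hQ, Or.inl h⟩
    · exact ⟨hQ, Or.inr (Or.inr ⟨conn_refl _ _ _, h⟩)⟩

omit [Fintype E] [DecidableEq E] [LinearOrder R] [IsStrictOrderedRing R] in
/-- `Q ∩ {a₂ ↮ o} ∩ {a₁ ↮ b} ∩ {o ↔ b} = PD_o ∩ {o ↔ b}`. -/
lemma Q_not_oH_not_bL_ob_eq (o a₁ : V) :
    avoidAll ends a₂ {a₁} ∩ (connEvent ends a₂ o)ᶜ ∩ (connEvent ends a₁ b)ᶜ ∩ connEvent ends o b =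
      PDEvent ends a₁ a₂ o ∩ connEvent ends o b := by
  ext ω
  simp only [Set.mem_inter_iff, Set.mem_compl_iff, mem_Q_iff', mem_PD_iff, mem_connEvent]
  constructor
  · rintro ⟨⟨⟨h12, h2o⟩, h1b⟩, hob⟩
    exact ⟨⟨h12, fun h => h1b (conn_trans (conn_symm h) hob), fun h => h2o (conn_symm h)⟩, hob⟩
  · rintro ⟨⟨h12, ho1, ho2⟩, hob⟩
    exact ⟨⟨⟨h12, fun h => ho2 (conn_symm h)⟩, fun h => ho1 (conn_trans hob (conn_symm h))⟩, hob⟩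

omit [LinearOrder R] [IsStrictOrderedRing R] in
/-- `P(Q ∩ {a₂ ↮ o} ∩ ({a₁ ↔ b} ∪ {o ↔ b})) = P(Q ∩ bL) − P(Q ∩ (oH ∩ bL)) + P(PD_o ∩ {o ↔ b})`. -/
lemma prob_Q_not_oH_bL (o a₁ : V) :
    prob p (avoidAll ends a₂ {a₁} ∩ (connEvent ends a₂ o)ᶜ ∩ (connEvent ends a₁ b ∪ connEvent ends o b)) =
      prob p (avoidAll ends a₂ {a₁} ∩ connEvent ends a₁ b) -
        prob p (avoidAll ends a₂ {a₁} ∩ (connEvent ends a₂ o ∩ connEvent ends a₁ b)) +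
        prob p (PDEvent ends a₁ a₂ o ∩ connEvent ends o b) := by
  have hsplit : avoidAll ends a₂ {a₁} ∩ (connEvent ends a₂ o)ᶜ ∩ (connEvent ends a₁ b ∪ connEvent ends o b) =
      (avoidAll ends a₂ {a₁} ∩ (connEvent ends a₂ o)ᶜ ∩ connEvent ends a₁ b) ∪
        (avoidAll ends a₂ {a₁} ∩ (connEvent ends a₂ o)ᶜ ∩ (connEvent ends a₁ b)ᶜ ∩ connEvent ends o b) := by
    ext ω; simp only [Set.mem_inter_iff, Set.mem_union, Set.mem_compl_iff]; tauto
  have hdisj : Disjoint (avoidAll ends a₂ {a₁} ∩ (connEvent ends a₂ o)ᶜ ∩ connEvent ends a₁ b)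
      (avoidAll ends a₂ {a₁} ∩ (connEvent ends a₂ o)ᶜ ∩ (connEvent ends a₁ b)ᶜ ∩ connEvent ends o b) := by
    rw [Set.disjoint_left]
    rintro ω ⟨-, h⟩ ⟨⟨-, h'⟩, -⟩
    exact h' h
  rw [hsplit, prob_union_of_disjoint p hdisj, Q_not_oH_not_bL_ob_eq]
  have h := prob_inter_add_prob_inter_compl p (avoidAll ends a₂ {a₁} ∩ connEvent ends a₁ b) (connEvent ends a₂ o)
  have e1 : avoidAll ends a₂ {a₁} ∩ connEvent ends a₁ b ∩ connEvent ends a₂ o =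
      avoidAll ends a₂ {a₁} ∩ (connEvent ends a₂ o ∩ connEvent ends a₁ b) := by
    ext ω; simp only [Set.mem_inter_iff]; tauto
  have e2 : avoidAll ends a₂ {a₁} ∩ connEvent ends a₁ b ∩ (connEvent ends a₂ o)ᶜ =
      avoidAll ends a₂ {a₁} ∩ (connEvent ends a₂ o)ᶜ ∩ connEvent ends a₁ b := by
    ext ω; simp only [Set.mem_inter_iff, Set.mem_compl_iff]; tauto
  rw [e1, e2] at h
  linear_combination h

omit [LinearOrder R] [IsStrictOrderedRing R] in
include hf in
/-- **THE EXACT COUPLING OF `L¹`** across the `o`-edge `f = {o, a₁}`: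
`P¹(Q, a₁ ↔ b) = P⁰(Q, a₁ ↔ b) − P⁰(Q, a₂ ↔ o, a₁ ↔ b) + P⁰(PD_o, o ↔ b)` (the equality version of g18's
`prob_Q_conn1_update_one_ge`: `b ∈ C₁` afterwards iff `b ∈ C₁` before with `o ∉ C₂`, or `o ∉ U` and `o ↔ b`). -/
theorem prob_Q_conn1_update_one_eq :
    prob (Function.update p f 1) (avoidAll ends a₂ {a₁} ∩ connEvent ends a₁ b) =
      prob (Function.update p f 0) (avoidAll ends a₂ {a₁} ∩ connEvent ends a₁ b) -
        prob (Function.update p f 0) (avoidAll ends a₂ {a₁} ∩ (connEvent ends a₂ o ∩ connEvent ends a₁ b)) +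
        prob (Function.update p f 0) (PDEvent ends a₁ a₂ o ∩ connEvent ends o b) := by
  rw [RootEdge.prob_update_one_eq_prob_update_zero_of_iff p _ _ (Q_conn1_update_true_iff ends a₂ b hf),
    prob_Q_not_oH_bL]

omit [LinearOrder R] [IsStrictOrderedRing R] in
include hf in
/-- The coupling mass vanishes with the `o`-edge open: `P¹(PD_o ∩ {o ↔ b}) = 0`. -/
theorem prob_PDo_ob_update_one :
    prob (Function.update p f 1) (PDEvent ends a₁ a₂ o ∩ connEvent ends o b) = 0 := by
  have hiff : ∀ ω : Config E, Function.update ω f true ∈ PDEvent ends a₁ a₂ o ∩ connEvent ends o b ↔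
      Function.update ω f false ∈ (∅ : Set (Config E)) := by
    intro ω
    simp only [Set.mem_inter_iff, mem_PD_iff, Set.mem_empty_iff_false, iff_false]
    rintro ⟨⟨-, h, -⟩, -⟩
    exact h (conn_of_openAdj ⟨f, by simp, hf⟩)
  rw [RootEdge.prob_update_one_eq_prob_update_zero_of_iff p _ _ hiff, prob_empty]

end Coupling

section Main

variable {V : Type*} {E : Type*} [Fintype E] [DecidableEq E] [Fintype V] [DecidableEq V] {R : Type*}
  [Field R] [LinearOrder R] [IsStrictOrderedRing R]

variable (p : E → R) (ends : E → Sym2 V) {o a₁ a₂ a₃ : V} (b : V) {g e d f : E}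

omit [Fintype E] [DecidableEq E] [Fintype V] [DecidableEq V] [Field R] [LinearOrder R] [IsStrictOrderedRing R] in
/-- The three edges of the star are distinct: `g ≠ e`. -/
lemma star3_ne_ge (hg : ends g = s(a₃, o)) (he : ends e = s(a₃, a₁)) (h13 : a₁ ≠ a₃) (ho1 : o ≠ a₁) :
    g ≠ e := by
  intro h
  rw [h, he] at hg
  rcases Sym2.eq_iff.1 hg with ⟨-, h2⟩ | ⟨-, h2⟩
  · exact ho1 h2.symm
  · exact h13 h2

omit [Fintype E] [DecidableEq E] [Fintype V] [DecidableEq V] [Field R] [LinearOrder R] [IsStrictOrderedRing R] in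
/-- `g ≠ d`. -/
lemma star3_ne_gd (hg : ends g = s(a₃, o)) (hd : ends d = s(a₃, a₂)) (h23 : a₂ ≠ a₃) (ho2 : o ≠ a₂) :
    g ≠ d := by
  intro h
  rw [h, hd] at hg
  rcases Sym2.eq_iff.1 hg with ⟨-, h2⟩ | ⟨-, h2⟩
  · exact ho2 h2.symm
  · exact h23 h2

omit [Fintype E] [DecidableEq E] [Fintype V] [DecidableEq V] [Field R] [LinearOrder R] [IsStrictOrderedRing R] in
/-- `e ≠ d`. -/
lemma star3_ne_ed (he : ends e = s(a₃, a₁)) (hd : ends d = s(a₃, a₂)) (h12 : a₁ ≠ a₂) (h23 : a₂ ≠ a₃) :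
    e ≠ d := by
  intro h
  rw [h, hd] at he
  rcases Sym2.eq_iff.1 he with ⟨-, h2⟩ | ⟨-, h2⟩
  · exact h12 h2.symm
  · exact h23 h2

omit [Fintype E] [DecidableEq E] [Fintype V] [DecidableEq V] [Field R] [LinearOrder R] [IsStrictOrderedRing R] in
/-- `d ≠ f`. -/
lemma star3_ne_df (hd : ends d = s(a₃, a₂)) (hf : ends f = s(o, a₁)) (h13 : a₁ ≠ a₃) (ho3 : o ≠ a₃) :
    d ≠ f := by
  intro h
  rw [h, hf] at hd
  rcases Sym2.eq_iff.1 hd with ⟨h1, -⟩ | ⟨-, h2⟩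
  · exact ho3 h1
  · exact h13 h2

omit [Fintype E] [Fintype V] [DecidableEq V] [LinearOrder R] [IsStrictOrderedRing R] in
/-- `p[f ↦ 0][g ↦ 0][e ↦ 0][d ↦ 0] = p[g ↦ 0][e ↦ 0][d ↦ 0][f ↦ 0]`. -/
lemma upd_f0_3 (hgf : g ≠ f) (hef : e ≠ f) (hdf : d ≠ f) :
    Function.update (Function.update (Function.update (Function.update p f 0) g 0) e 0) d 0 =
      Function.update (Function.update (Function.update (Function.update p g 0) e 0) d 0) f 0 := by
  rw [Function.update_comm hgf.symm, Function.update_comm hef.symm, Function.update_comm hdf.symm]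

/-- **THE THREE-PIN STAR: the `o`-class `D·Z`-chord along `f = {o, a₁}`** (`NMixChord normDZ`), for `a₃` with
exactly the three edges `g = {a₃, o}`, `e = {a₃, a₁}`, `d = {a₃, a₂}` (any weights). -/
theorem dzChord_o_edge_of_three_pin_star (hp : IsProbVec p) (hf : ends f = s(o, a₁)) (hg : ends g = s(a₃, o))
    (he : ends e = s(a₃, a₁)) (hd : ends d = s(a₃, a₂))
    (hstar3 : ∀ e', a₃ ∈ ends e' → e' = g ∨ e' = e ∨ e' = d)
    (h12 : a₁ ≠ a₂) (h13 : a₁ ≠ a₃) (h23 : a₂ ≠ a₃) (ho1 : o ≠ a₁) (ho2 : o ≠ a₂) (ho3 : o ≠ a₃) (hb3 : b ≠ a₃) :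
    NMixChord (normDZ ends a₁ a₂ a₃) p ends o a₁ a₂ a₃ b f := by
  have hge : g ≠ e := star3_ne_ge ends hg he h13 ho1
  have hgd : g ≠ d := star3_ne_gd ends hg hd h23 ho2
  have hed : e ≠ d := star3_ne_ed ends he hd h12 h23
  have hgf : g ≠ f := star_ne_gf ends hg hf h13 ho3
  have hef : e ≠ f := star_ne_ef ends he hf h13 ho3
  have hdf : d ≠ f := star3_ne_df ends hd hf h13 ho3
  have hpf : IsProbVec (Function.update p f 0) := hp.update f le_rfl zero_le_one
  -- `Gc` vanishes with the `o`-edge open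
  have hG1 : Gc (Function.update p f 1) ends o a₁ a₂ a₃ b = 0 :=
    Gc_eq_zero_of_sure_conn_o _ ends o a₃ b (conn_a1_o_of_update_one p ends hf)
  unfold NMixChord normDZ
  rw [hG1, mul_zero, sub_zero]
  -- the base instance and its `o`-edge pins
  set p₀ := Function.update (Function.update (Function.update p g 0) e 0) d 0 with hp₀
  have hp00 : IsProbVec p₀ :=
    ((hp.update g le_rfl zero_le_one).update e le_rfl zero_le_one).update d le_rfl zero_le_one
  have hp0 : IsProbVec (Function.update p₀ f 0) := hp00.update f le_rfl zero_le_one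
  have hqf : p₀ f = p f := by
    rw [hp₀, Function.update_of_ne hdf.symm, Function.update_of_ne hef.symm, Function.update_of_ne hgf.symm]
  have hZ0n := prob_nonneg hp0 (avoidAll ends a₂ {a₁})
  rcases eq_or_lt_of_le hZ0n with hZ0 | hZ0
  · -- the degenerate case: `Z⁰ = 0` forces `Z(p[f ↦ 0]) = 0`, both sides vanish
    have hle1 := EdmRow.prob_le_prob_update_zero_of_isLowerSet hpf (EdmRow.isLowerSet_avoidAll ends a₁ a₂) g
    have hle2 := EdmRow.prob_le_prob_update_zero_of_isLowerSet (hpf.update g le_rfl zero_le_one)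
      (EdmRow.isLowerSet_avoidAll ends a₁ a₂) e
    have hle3 := EdmRow.prob_le_prob_update_zero_of_isLowerSet
      ((hpf.update g le_rfl zero_le_one).update e le_rfl zero_le_one) (EdmRow.isLowerSet_avoidAll ends a₁ a₂) d
    rw [upd_f0_3 p hgf hef hdf, ← hp₀, ← hZ0] at hle3
    have hZf : prob (Function.update p f 0) (avoidAll ends a₂ {a₁}) = 0 :=
      le_antisymm (hle1.trans (hle2.trans hle3)) (prob_nonneg hpf _)
    have hGf : Gc (Function.update p f 0) ends o a₁ a₂ a₃ b = 0 :=
      Chord.Gc_eq_zero_of_degenerate hpf ends o a₁ a₂ a₃ b (by rw [hZf, mul_zero])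
    have hGp : Gc p ends o a₁ a₂ a₃ b = 0 :=
      Gc_eq_zero_of_normDZ_update_zero (e := f) hp (by unfold normDZ; rw [hZf, mul_zero])
    rw [hGf, hGp, hZf]
    simp
  -- the main case: the dictionary at `p` and at `p[f ↦ 0]`
  -- at `p₀[f ↦ 1]`, `o ∈ C₁` surely
  have hc1 := conn_a1_o_of_update_one p₀ ends hf
  have hHo1 := prob_Q_conn₂_eq_zero (Function.update p₀ f 1) ends (a₂ := a₂) hc1
  have hLo1 := prob_inter_conn_eq' (Function.update p₀ f 1) ends hc1 (avoidAll ends a₂ {a₁})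
  have hLL1 := prob_inter_conn_eq (Function.update p₀ f 1) ends hc1 (avoidAll ends a₂ {a₁}) (connEvent ends a₁ b)
  have hLH1 := prob_inter_conn_eq (Function.update p₀ f 1) ends hc1 (avoidAll ends a₂ {a₁}) (connEvent ends a₂ b)
  have hHL1 := prob_inter_conn₂_eq_zero (Function.update p₀ f 1) ends (a₂ := a₂) hc1 (avoidAll ends a₂ {a₁})
    (connEvent ends a₁ b) le_rfl
  have hHH1 := prob_inter_conn₂_eq_zero (Function.update p₀ f 1) ends (a₂ := a₂) hc1 (avoidAll ends a₂ {a₁})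
    (connEvent ends a₂ b) le_rfl
  have hW1 := prob_PDo_ob_update_one p₀ ends a₂ b hf
  -- g18's couplings across the `o`-edge, and the exact coupling of `L¹`
  have hZ1 := RootEdge.prob_Q_update_one p₀ ends (a₂ := a₂) hf
  rw [TEvent_o] at hZ1
  have hB1 := RootEdge.prob_Q_conn2_update_one p₀ ends (a₂ := a₂) hf b
  rw [TEvent_o_inter] at hB1
  have hL1 := prob_Q_conn1_update_one_eq p₀ ends a₂ b hf
  -- the pins of the `o`-edge
  have pZ := prob_eq_pin p₀ (avoidAll ends a₂ {a₁}) f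
  have pLo := prob_eq_pin p₀ (avoidAll ends a₂ {a₁} ∩ connEvent ends a₁ o) f
  have pHo := prob_eq_pin p₀ (avoidAll ends a₂ {a₁} ∩ connEvent ends a₂ o) f
  have pLb := prob_eq_pin p₀ (avoidAll ends a₂ {a₁} ∩ connEvent ends a₁ b) f
  have pHb := prob_eq_pin p₀ (avoidAll ends a₂ {a₁} ∩ connEvent ends a₂ b) f
  have pLL := prob_eq_pin p₀ (avoidAll ends a₂ {a₁} ∩ (connEvent ends a₁ o ∩ connEvent ends a₁ b)) f
  have pLH := prob_eq_pin p₀ (avoidAll ends a₂ {a₁} ∩ (connEvent ends a₁ o ∩ connEvent ends a₂ b)) f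
  have pHL := prob_eq_pin p₀ (avoidAll ends a₂ {a₁} ∩ (connEvent ends a₂ o ∩ connEvent ends a₁ b)) f
  have pHH := prob_eq_pin p₀ (avoidAll ends a₂ {a₁} ∩ (connEvent ends a₂ o ∩ connEvent ends a₂ b)) f
  have pW := prob_eq_pin p₀ (PDEvent ends a₁ a₂ o ∩ connEvent ends o b) f
  rw [hqf] at pZ pLo pHo pLb pHb pLL pLH pHL pHH pW
  -- `B¹` at the `o`-weight `q` (the hypothesis of the dictionary)
  have hB1q : prob (Function.update p₀ f 1) (avoidAll ends a₂ {a₁} ∩ connEvent ends a₂ b) =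
      prob p₀ (avoidAll ends a₂ {a₁} ∩ connEvent ends a₂ b) -
        prob p₀ (avoidAll ends a₂ {a₁} ∩ (connEvent ends a₂ o ∩ connEvent ends a₂ b)) := by
    rw [pHb, pHH, hHH1, hB1]; ring
  have hB10 : prob (Function.update (Function.update (Function.update (Function.update
      (Function.update p f 0) g 0) e 0) d 0) f 1) (avoidAll ends a₂ {a₁} ∩ connEvent ends a₂ b) =
      prob (Function.update (Function.update (Function.update (Function.update p f 0) g 0) e 0) d 0)
        (avoidAll ends a₂ {a₁} ∩ connEvent ends a₂ b) -
        prob (Function.update (Function.update (Function.update (Function.update p f 0) g 0) e 0) d 0)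
          (avoidAll ends a₂ {a₁} ∩ (connEvent ends a₂ o ∩ connEvent ends a₂ b)) := by
    rw [upd_f0_3 p hgf hef hdf, Function.update_idem, ← hp₀]
    exact hB1
  rw [Gc_star3 p hg he hd hstar3 hf hge hgd hed hgf hef hdf h13 h23 ho3 hb3 hB1q,
    N_star3 p hg he hd hstar3 hf hge hgd hed hgf hef hdf h13 h23,
    Gc_star3 (Function.update p f 0) hg he hd hstar3 hf hge hgd hed hgf hef hdf h13 h23 ho3 hb3 hB10,
    N_star3 (Function.update p f 0) hg he hd hstar3 hf hge hgd hed hgf hef hdf h13 h23,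
    upd_f0_3 p hgf hef hdf, Function.update_idem, ← hp₀, Function.update_of_ne hgf, Function.update_of_ne hef,
    Function.update_of_ne hdf]
  -- the nonnegative masses at `p₀[f ↦ 0]`
  have hLo0 := prob_nonneg hp0 (avoidAll ends a₂ {a₁} ∩ connEvent ends a₁ o)
  have hHo0 := prob_nonneg hp0 (avoidAll ends a₂ {a₁} ∩ connEvent ends a₂ o)
  have hN0 : 0 ≤ prob (Function.update p₀ f 0) (avoidAll ends a₂ {a₁}) -
      prob (Function.update p₀ f 0) (avoidAll ends a₂ {a₁} ∩ connEvent ends a₁ o) -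
      prob (Function.update p₀ f 0) (avoidAll ends a₂ {a₁} ∩ connEvent ends a₂ o) := by
    have h := prob_PD_v_univ (Function.update p₀ f 0) ends a₁ a₂ o
    have h0 := prob_nonneg hp0 (PDEvent ends a₁ a₂ o)
    linarith
  have hW0 := prob_nonneg hp0 (PDEvent ends a₁ a₂ o ∩ connEvent ends o b)
  -- the four covariance signs at `p₀[f ↦ 0]`
  have hsLL := PendantRoot.covC_same_nonneg (Function.update p₀ f 0) ends hp0 o a₁ a₂ b
  unfold PendantRoot.covC at hsLL
  have hsHH := PendantRoot.covC_same_nonneg (Function.update p₀ f 0) ends hp0 o a₂ a₁ b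
  rw [covC_root_swap] at hsHH
  unfold PendantRoot.covC at hsHH
  have hs := PendantRoot.covC_cross_nonpos (Function.update p₀ f 0) ends hp0 o a₁ a₂ b
  unfold PendantRoot.covC at hs
  obtain ⟨hsHL, hsLH⟩ := hs
  -- the algebraic key
  exact star3_key_dz _ _ _ _ _ _ _ _ _ _ (p f) _ _ _ _ _ _ _ _ _ _ _ _ (p g) (p e) (p d)
    (by rw [pZ]; ring) (by rw [pLo, hLo1]; ring) (by rw [pHo, hHo1]; ring) (by rw [pLb]; ring)
    (by rw [pHb, hB1]; ring) (by rw [pLL, hLL1]; ring) (by rw [pLH, hLH1, hB1]; ring) (by rw [pHL, hHL1]; ring)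
    (by rw [pHH, hHH1]; ring) (by rw [pW, hW1]; ring) hZ1 hL1
    hZ0 hLo0 hHo0 hN0 hW0 (hp.nonneg f) (hp.le_one f) (hp.nonneg g) (hp.le_one g) (hp.nonneg e) (hp.le_one e)
    (hp.nonneg d) (hp.le_one d) hsLL hsHH hsLH hsHL

end Main

end OStar3

end Mix

end Summit.Ventures.PercRepro2
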